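import Summits.Langlands.Langlands.Theses.MirrorPairReflection
import Summits.Langlands.Langlands.Theorems.IrreducibilityBySelfDualityIrreducibleOffSectorLanglandsOfReciprocity
import Summits.Langlands.Langlands.Theorems.IrreducibilityBySelfDualityReciprocityUpToIrreducibilityIsobaricRigidity
import Summits.Langlands.Langlands.Theorems.IrreducibilityBySelfDualityReciprocityUpToIrreducibilityDeRhamBlocks
import Summits.Langlands.Langlands.Theorems.IrreducibilityBySelfDualityReciprocityUpToIrreducibilityGeometricConstituents
import Literature.NumberTheory.Automorphic.IsAutomorphicAE
import Literature.NumberTheory.Automorphic.GLnAdelicStructureProofs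
import HarnessLib

/-!
# Birth skeleton (BC3) for crux stmt-Langlands-12840
`Summit.Langlands.Langlands.Theses.MirrorPairReflection.SectorComplement` — line `birth_MirrorPairReflection`

Route `route-Langlands-MirrorPairReflection` (deciding theorem `closes : KummerHerbrandSplitting → MirrorCriterion →
NonSelfMirrorReducible → SelfMirrorDihedral → ScalarResidueReducible → SectorComplement → _root_.Langlands`, rev 3).
The crux is the route's D-0027 frame item (rank 9, auto-crux'd 2026-08-16 because `closes` assumes it):

  `SectorComplement := EvenReducibleResidueClassification → _root_.Langlands`,

where `X := EvenReducibleResidueClassification` (the route TARGET, stmt-Langlands-12833) classifies the even,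
residually reducible, conductor-`p^∞` sector of direction (B) for `GL₂/ℚ`, `p` odd: every continuous
`σ : Γ_ℚ → GL₂(ℚ̄_p)` unramified outside `p`, of residual type `ω^a ⊕ ω^b` (trace congruence) with `a + b` even,
irreducible, is DIHEDRAL — `p ≡ 1 (mod 4)`, self-mirror index, `p ∣ B_{(p−1)/2}`, and `σ` diagonal on `Γ_{ℚ(√p)}`.
Four refuter passes + the grounder agree: `SectorComplement` is target-equivalent by design ("the rest of the summit",
`Langlands → SectorComplement := fun h _ => h`), open-problem, nothing to refute; no Disproof.lean on the crux (2026-08-17).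

File name: the crux directory `Cruxes/SectorComplement/` is SHARED with the homonymous cruxes of routes
SkinnerWilesDefectOne (stmt-Langlands-12923, `NOTES.md`) and HolomorphicShadow (stmt-Langlands-14623, whose registered
`Lines/birth.lean` must not be clobbered), hence `Lines/birth_MirrorPairReflection.lean` and the namespace suffix below.

## The skeleton: `Langlands` along the structural seam W / B_w / LGC / JS, with B_w cut along X's sector

The only typed decomposition of the summit certified in the tree (crux-strategist of `CapacityClassicality.SectorToLanglands`,
stmt-Langlands-10368, `Cruxes/SectorToLanglands/Lines/SectorToLanglandsOfLeaves.lean`, rc 0, 0 sorry; the text form of the landed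
decoupling `ReciprocityUpToIrreducibility.reciprocityUpToIrreducibility_of_weak`, p116715; re-used verbatim by the sibling birth
skeleton `Cruxes/SectorComplement/Lines/birth.lean` of stmt-Langlands-14623) is

  `W → B_w → LGC → JS (2.2) → JS (2.3) → Langlands`

(W = Buzzard–Gee Conj. 3.2.2 weak form: a pinned-geometric avatar, Satake–Frobenius compatible a.e.; B_w = Fontaine–Mazur–
Langlands, a.e. form; LGC = Taylor 2004 Conj. 7 for irreducible pinned-geometric a.e.-compatible pairs, the only clause carrying
`∃ Rec`; JS = Arthur–Clozel Ch. 3 (2.2)/(2.3) for Borel–Jacquet data, the Literature named facts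
`JacquetShalika1981_partialPairL_boundary_repData` / `…_pole_repData`).  Its seam is NOT trivial: direction (A) needs the avatar of W
to be IRREDUCIBLE — the isobaric bootstrap (landed `stub_geometricConstituents` p99702 / `stub_deRhamBlocks` p98936 /
`stub_isobaricRigidity` p105601) run with B_w — and then the landed structural theorem
`IrreducibleOffSector.langlands_of_reciprocityUpToIrreducibility_text_of_JS` (Chebotarev–Brauer–Nesbitt uniqueness up to conjugacy).

THIS file makes the crux's hypothesis `X` load-bearing by cutting B_w along **X's sector**, typed over a general number field `K`
and rank `n` as
`[K:ℚ] = 1 ∧ n = 2 ∧ ℓ ≠ 2 ∧ (ρ unramified at every v ∤ ℓ) ∧ ∃ a b, Even (a + b) ∧ ∀ g, ‖tr ρ(g) − χ_ℓ(g)^a − χ_ℓ(g)^b‖ < 1`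
(`χ_ℓ = GaloisRep.cyclotomicCharacter K ℓ`; for `n = 2 < ℓ` the trace congruence says `ρ̄^ss = ω^a ⊕ ω^b`, and `a + b` even
says `det ρ(c) = +1`, exactly as X types evenness):

* `stub_weakExistence` — W (open beyond regular algebraic `π` over CM / totally real `K`; verbatim the sibling child `WeakExistence`);
* `stub_weakAutomorphyOffSector` — B_w OFF X's sector (open: Fontaine–Mazur–Langlands for all `n`, all `K`, minus the one even
  residually-reducible conductor-`ℓ^∞` plane of `GL₂/ℚ`);
* `stub_sectorAutomorphyOfClassification` — `X →` B_w ON the sector: **the stub that uses X** (true in substance, size L–XL).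
  Content: transport `K ≃+* ℚ` (unique); by X an irreducible `ρ` in the sector is diagonal on `Γ_{ℚ(√ℓ)}` in some frame, hence
  (index 2, Clifford / Frobenius reciprocity) `ρ ≅ Ind_{ℚ(√ℓ)}^ℚ χ` for a continuous character `χ` of `Γ_{ℚ(√ℓ)}` unramified
  outside `ℓ`; `ρ` de Rham at `ℓ` ⇒ `χ` de Rham above `ℓ` ⇒ (Serre 1968 Ch. III §2.3–3.1: locally algebraic abelian
  representations come from algebraic Hecke characters; `ℚ(√ℓ)` totally real ⇒ type `A₀` characters are `N^w ·` finite order,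
  Weil 1956) `χ = ψ · χ_cyc^w` with `ψ` of finite order, so `ρ ≅ Ind(ψ) ⊗ χ_cyc^w` with `Ind ψ` an EVEN dihedral Artin
  representation; automorphic induction from the real quadratic field (Maass 1949 — these are Maass's own wave forms —,
  Jacquet–Langlands 1970 Thm. 12.2 / Prop. 12.1, Labesse–Langlands 1979) gives a cuspidal (`ψ ≠ ψ^τ` since `ρ` is irreducible)
  `π(Ind ψ)` on `GL₂(𝔸_ℚ)` with `π_∞` the `λ = 1/4` principal series — L-algebraic, parameter `(0,0)` — and the integral twist
  `|det|^{−w}` keeps L-algebraicity; Satake–Frobenius matching a.e. in the `ι⁻¹(α_j⁻¹)` normalisation of `SatakeFrobCompatibleAt`;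
* `stub_pairCompatibility` — LGC (open in general; verbatim the sibling child `PairCompatibility`);
* `stub_pairLBoundaryJS`, `stub_pairLPoleJS` — the two Jacquet–Shalika named facts BY NAME (known theorems, Literature T0 debts).

`SectorComplement_of` (kernel-checked, no `sorry`; hypotheses = the six stub statements by name via `_Goal.stub_x := type_of% @stub_x`):
given `X`, rebuild B_w by a case split on the sector, then the sibling bootstrap verbatim.  `lean check`: sorries = the six stubs only.

Disproof used: none exists for this crux (`ledger crux ls stmt-Langlands-12840`, 2026-08-17: NOTES.md of 12923 and the birth files of
14623 only; no `Disproof.lean`; no landed `Theorems/SectorComplement/Negative/`).  The 12923 NOTES §3 (L3) analysis — "stubs ⊇ Langlands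
minus the sector" — is exactly the shape adopted, with the sector typed and X used on it.  Negatives index (`ledger negatives`): the
K3 Kuga–Satake anchor (stmt-Langlands-3797) only — untouched.

References: K. Buzzard, T. Gee, LMS LNS 414 (2014), Conj. 3.2.1–3.2.2 [BuzzardGeeLMS2014]; J.-M. Fontaine, B. Mazur (1995), Conj. 1
[FontaineMazurGeometric1995]; R. Taylor, Ann. Fac. Sci. Toulouse 13 (2004), Conj. 7–8 [TaylorGaloisRepresentations2004];
J. Arthur, L. Clozel, Ann. Math. Stud. 120, Ch. 3 §2 (2.2)–(2.3) [ArthurClozelAMS120]; H. Jacquet, R. P. Langlands, SLN 114 (1970),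
§12 [JacquetLanglands1970]; H. Maass, Math. Ann. 121 (1949) [Maass1949]; J.-P. Serre, *Abelian ℓ-adic representations* (1968), Ch. III
[SerreAbelianLadic1968]; F. Calegari, ICM 2022 survey §12 [Calegari2023].
-/

noncomputable section

set_option linter.dupNamespace false -- project-wide option; `Summit.Langlands.Langlands` is the mandated namespace

open scoped NumberField Classical Polynomial Topology
open Filter IsDedekindDomain Polynomial
open Literature.NumberTheory.Automorphic Literature.NumberTheory.GaloisRepresentations
open Summit.Langlands
open Summit.Langlands.Langlands.Theorems.ReciprocityUpToIrreducibility
open Summit.Langlands.Langlands.Theses.MirrorPairReflection (SectorComplement EvenReducibleResidueClassification)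

namespace Summit.Langlands.Langlands.Cruxes.SectorComplement.BirthMirrorPairReflection

/-! ## 0. The crux's hypothesis `X`, by name -/

/-- The crux IS `X → Langlands`, definitionally. [folklore] -/
theorem sectorComplement_iff : SectorComplement ↔ (EvenReducibleResidueClassification → _root_.Langlands) :=
  Iff.rfl

/-! ## 1. The six stubs (the ONLY sorries of this file) -/

/-- **stub W — weak existence** (Buzzard–Gee Conj. 3.2.2, weak form; OPEN beyond regular algebraic `π` over CM / totally real
`K` — Harris–Lan–Taylor–Thorne 2016 Thm A + Scholze 2015 V.4.2 give the avatar there, de Rham by A'Campo 2024 / Caraiani–Newton in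
the crystalline range; nothing for irregular `π` (NonRegularWeightBarrier) or for `K` neither CM nor totally real
(ShimuraVarietyRealizationBarrier)): every L-algebraic cuspidal `π` of `GL_n(𝔸_K)` has, for all `ℓ, ι`, SOME
`ρ : Γ_K → GL_n(ℚ̄_ℓ)` unramified a.e., de Rham above `ℓ` for Fontaine's pinned datum, and Satake–Frobenius compatible with `π` a.e.
Verbatim the text of the sibling child `CapacityClassicality.WeakExistence`.
Why it might fail: it is the existence half of (A) of the summit, a.e. form.
[cite: BuzzardGeeLMS2014, Conj. 3.2.2] [cite: FontaineMazurGeometric1995, §1] -/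
theorem stub_weakExistence : ∀ (K : Type) [Field K] [NumberField K] (n : ℕ) (hcpt : Literature.NumberTheory.Automorphic.isCompact_glFiniteIntegralLevel n K), 0 < n → ∀ π : Literature.NumberTheory.Automorphic.CuspidalAutomorphicRepData n K hcpt, π.1.IsLAlgebraic → ∀ (ℓ : ℕ) [Fact ℓ.Prime] (ι : PadicAlgCl ℓ ≃+* ℂ), ∃ ρ : Literature.NumberTheory.GaloisRepresentations.FramedGaloisRep K (PadicAlgCl ℓ) n, ((∀ᶠ v : IsDedekindDomain.HeightOneSpectrum (NumberField.RingOfIntegers K) in cofinite, ρ.IsUnramifiedAt v) ∧ ∀ (v : IsDedekindDomain.HeightOneSpectrum (NumberField.RingOfIntegers K)) (hv : ((ℓ : ℕ) : NumberField.RingOfIntegers K) ∈ v.asIdeal), (Literature.NumberTheory.PAdicHodge.fontainePstAdicCompletion v ℓ hv).IsDeRhamFramed (ρ.toLocal v)) ∧ ∀ᶠ v : IsDedekindDomain.HeightOneSpectrum (NumberField.RingOfIntegers K) in cofinite, SatakeFrobCompatibleAt ι π.1 ρ v := by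
  sorry

/-- **stub B_w⁻ — weak automorphy OFF X's sector** (Fontaine–Mazur 1995 Conj. 1 + Langlands, a.e. form, for every `n ≥ 1` and
every number field `K`, EXCEPT the sector `[K:ℚ] = 1 ∧ n = 2 ∧ ℓ ≠ 2 ∧ ρ unramified outside ℓ ∧ ρ̄^ss = ω^a ⊕ ω^b with a + b even`;
OPEN — known for odd `GL₂/ℚ` with big residual image (Kisin, Emerton, Pan 2022), regular Hodge–Tate weights under the
automorphy-lifting provisos (BLGGT 2014, ACC+ 2023), `GL₁` (class field theory); open for irregular weights, `n ≥ 3` non-self-dual,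
general `K`, and for EVEN `GL₂/ℚ` with irreducible residue or ramification away from `ℓ`): every irreducible
`ρ : Γ_K → GL_n(ℚ̄_ℓ)` unramified a.e. and de Rham above `ℓ` (pinned datum), NOT in the sector, has an L-algebraic cuspidal `π`
Satake–Frobenius compatible a.e.
Why it might fail: it is (B) of the summit minus one plane.  [cite: FontaineMazurGeometric1995, Conj. 1]
[cite: BuzzardGeeLMS2014, Conj. 3.2.2] [cite: BarnetlambEtAl2014, Thm. A] [cite: Pan2022, Thm. 1.0.4] -/
theorem stub_weakAutomorphyOffSector : ∀ (K : Type) [Field K] [NumberField K] (n : ℕ) (hcpt : Literature.NumberTheory.Automorphic.isCompact_glFiniteIntegralLevel n K), 0 < n → ∀ (ℓ : ℕ) [Fact ℓ.Prime] (ι : PadicAlgCl ℓ ≃+* ℂ) (ρ : Literature.NumberTheory.GaloisRepresentations.FramedGaloisRep K (PadicAlgCl ℓ) n), ρ.toGaloisRep.IsIrreducible → ((∀ᶠ v : IsDedekindDomain.HeightOneSpectrum (NumberField.RingOfIntegers K) in cofinite, ρ.IsUnramifiedAt v) ∧ ∀ (v : IsDedekindDomain.HeightOneSpectrum (NumberField.RingOfIntegers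 K)) (hv : ((ℓ : ℕ) : NumberField.RingOfIntegers K) ∈ v.asIdeal), (Literature.NumberTheory.PAdicHodge.fontainePstAdicCompletion v ℓ hv).IsDeRhamFramed (ρ.toLocal v)) → ¬ (Module.finrank ℚ K = 1 ∧ n = 2 ∧ ℓ ≠ 2 ∧ (∀ v : IsDedekindDomain.HeightOneSpectrum (NumberField.RingOfIntegers K), ((ℓ : ℕ) : NumberField.RingOfIntegers K) ∉ v.asIdeal → ρ.IsUnramifiedAt v) ∧ ∃ a b : ℕ, Even (a + b) ∧ ∀ g : Field.absoluteGaloisGroup K, ‖Literature.NumberTheory.GaloisRepresentations.FramedRep.trace ρ g - ((algebraMap ℚ_[ℓ] (PadicAlgCl ℓ) (((Literature.NumberTheory.GaloisRepresentations.GaloisRep.cyclotomicCharacter K ℓ g : ℤ_[ℓ]ˣ) : ℤ_[ℓ]) : ℚ_[ℓ])) ^ a + (algebraMap ℚ_[ℓ] (PadicAlgCl ℓ) (((Literature.NumberTheory.GaloisRepresentations.GaloisRep.cyclotomicCharacter K ℓ g : ℤ_[ℓ]ˣ) : ℤ_[ℓ]) : ℚ_[ℓ])) ^ b)‖ < 1)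 → ∃ π : Literature.NumberTheory.Automorphic.CuspidalAutomorphicRepData n K hcpt, π.1.IsLAlgebraic ∧ ∀ᶠ v : IsDedekindDomain.HeightOneSpectrum (NumberField.RingOfIntegers K) in cofinite, SatakeFrobCompatibleAt ι π.1 ρ v := by
  sorry

/-- **stub B_w⁺ — X's sector from the classification `X`** (THE STUB THAT USES `X`; true in substance, size L–XL): granted `X`,
over a field `K` with `[K:ℚ] = 1`, every irreducible `ρ : Γ_K → GL₂(ℚ̄_ℓ)`, `ℓ` odd, unramified outside `ℓ`, de Rham above `ℓ`,
of residual type `ω^a ⊕ ω^b` with `a + b` even, has an L-algebraic cuspidal `π` on `GL₂(𝔸_K)` Satake–Frobenius compatible with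
`ρ` a.e. (roots `ι⁻¹(α_j⁻¹)` of the arithmetic Frobenius).
Proof plan: transport to `ℚ` (`K ≃+* ℚ` is unique); `X` (with `FramedRep.IsIrreducible = toGaloisRep.IsIrreducible`, `Iff.rfl`)
gives a frame `P` and `r`, `r² = ℓ`, with `PρP⁻¹` diagonal on `Γ_{ℚ(√ℓ)} = Stab(r)`; index `2` + irreducibility ⇒
`ρ ≅ Ind_{ℚ(√ℓ)}^ℚ χ`, `χ` a continuous character of `Γ_{ℚ(√ℓ)}` unramified outside `ℓ`, `χ ≠ χ^τ`; de Rham heredity ⇒ `χ` de Rham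
above `ℓ` ⇒ `χ = ψ · χ_cyc^w`, `ψ` of finite order (Serre 1968 III §2.3–§3.1 + Weil 1956: `ℚ(√ℓ)` is totally real); automorphic
induction from the real quadratic field (Maass 1949; Jacquet–Langlands 1970 Thm. 12.2; Labesse–Langlands 1979) ⇒ cuspidal
`π(Ind ψ) ⊗ |det|^{−w}`, L-algebraic (`π_∞` = `λ = 1/4` principal series shifted by an integer), Satake–Frobenius compatible a.e.
Why it might fail: only through a normalisation slip (dual / `ι` / the sign of `w`), each repairable inside the proof; the Lean
debts (induction from an index-2 subgroup, Serre's abelian theorem, AI for `GL₁ ↗ GL₂`) are Literature-sized.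
[cite: Maass1949, Satz 26] [cite: JacquetLanglands1970, Thm. 12.2] [cite: SerreAbelianLadic1968, Ch. III §2.3]
[cite: BuzzardGeeLMS2014, Def. 3.1.1 and Conj. 3.2.2] -/
theorem stub_sectorAutomorphyOfClassification : EvenReducibleResidueClassification → ∀ (K : Type) [Field K] [NumberField K], Module.finrank ℚ K = 1 → ∀ (hcpt : Literature.NumberTheory.Automorphic.isCompact_glFiniteIntegralLevel 2 K) (ℓ : ℕ) [Fact ℓ.Prime], ℓ ≠ 2 → ∀ (ι : PadicAlgCl ℓ ≃+* ℂ) (ρ : Literature.NumberTheory.GaloisRepresentations.FramedGaloisRep K (PadicAlgCl ℓ) 2), ρ.toGaloisRep.IsIrreducible → ((∀ᶠ v : IsDedekindDomain.HeightOneSpectrum (NumberField.RingOfIntegers K) in cofinite, ρ.IsUnramifiedAt v) ∧ ∀ (v : IsDedekindDomain.HeightOneSpectrum (NumberField.RingOfIntegers K)) (hv : ((ℓ : ℕ) : NumberField.RingOfIntegers K) ∈ v.asIdeal), (Literature.NumberTheory.PAdicHodge.fontainePstAdicCompletion v ℓ hv).IsDeRhamFramed (ρ.toLocal v)) → (∀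 v : IsDedekindDomain.HeightOneSpectrum (NumberField.RingOfIntegers K), ((ℓ : ℕ) : NumberField.RingOfIntegers K) ∉ v.asIdeal → ρ.IsUnramifiedAt v) → ∀ (a b : ℕ), Even (a + b) → (∀ g : Field.absoluteGaloisGroup K, ‖Literature.NumberTheory.GaloisRepresentations.FramedRep.trace ρ g - ((algebraMap ℚ_[ℓ] (PadicAlgCl ℓ) (((Literature.NumberTheory.GaloisRepresentations.GaloisRep.cyclotomicCharacter K ℓ g : ℤ_[ℓ]ˣ) : ℤ_[ℓ]) : ℚ_[ℓ])) ^ a + (algebraMap ℚ_[ℓ] (PadicAlgCl ℓ) (((Literature.NumberTheory.GaloisRepresentations.GaloisRep.cyclotomicCharacter K ℓ g : ℤ_[ℓ]ˣ) : ℤ_[ℓ]) : ℚ_[ℓ])) ^ b)‖ < 1) → ∃ π : Literature.NumberTheory.Automorphic.CuspidalAutomorphicRepData 2 K hcpt, π.1.IsLAlgebraic ∧ ∀ᶠ v : IsDedekindDomain.HeightOneSpectrum (NumberField.RingOfIntegers K) in cofinite, SatakeFrobCompatibleAt ι π.1 ρ v := by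
  sorry

/-- **stub LGC — local–global compatibility for compatible pairs** (Taylor 2004 Conj. 7 at EVERY finite place, through the
Grothendieck–Deligne recipe at `v ∤ ℓ` and Fontaine's pinned `D_pst` at `v ∣ ℓ`, for ONE reciprocity datum `Rec` per field —
the only clause carrying `∃ Rec`; OPEN in general: known for regular algebraic conjugate self-dual `π` over CM fields
(Harris–Taylor, Taylor–Yoshida, Caraiani) and `ℓ ≠ p` beyond (Varma), open for irregular `π` and at `v ∣ ℓ` in general; includes
the Harris–Taylor debt `LocalLanglandsDatum` of `Rec` itself): verbatim the text of the sibling child `CapacityClassicality.PairCompatibility`.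
Why it might fail: a.e.-compatible irreducible pairs with a local mismatch at a ramified place would refute it (none known).
[cite: TaylorGaloisRepresentations2004, Conj. 7] [cite: HarrisTaylorAMS2001, Thm. A] -/
theorem stub_pairCompatibility : ∀ (K : Type) [Field K] [NumberField K], ∃ Rec : ReciprocityData K, ∀ (n : ℕ) (hcpt : Literature.NumberTheory.Automorphic.isCompact_glFiniteIntegralLevel n K), 0 < n → ∀ (π : Literature.NumberTheory.Automorphic.CuspidalAutomorphicRepData n K hcpt), π.1.IsLAlgebraic → ∀ (ℓ : ℕ) [Fact ℓ.Prime] (ι : PadicAlgCl ℓ ≃+* ℂ) (ρ : Literature.NumberTheory.GaloisRepresentations.FramedGaloisRep K (PadicAlgCl ℓ) n), ρ.toGaloisRep.IsIrreducible → ((∀ᶠ v : IsDedekindDomain.HeightOneSpectrum (NumberField.RingOfIntegers K) in cofinite, ρ.IsUnramifiedAt v) ∧ ∀ (v : IsDedekindDomain.HeightOneSpectrum (NumberField.RingOfIntegers K)) (hv : ((ℓ : ℕ) : NumberField.RingOfIntegers K) ∈ v.asIdeal), (Literature.NumberTheory.PAdicHodge.fontainePstAdicCompletion v ℓ hv).IsDeRhamFramed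 (ρ.toLocal v)) → (∀ᶠ v : IsDedekindDomain.HeightOneSpectrum (NumberField.RingOfIntegers K) in cofinite, SatakeFrobCompatibleAt ι π.1 ρ v) → ∀ v : IsDedekindDomain.HeightOneSpectrum (NumberField.RingOfIntegers K), LocalGlobalCompatibleAt Rec ι π.1 ρ v := by
  sorry

/-- **stub JS (2.2)** — Jacquet–Shalika / Arthur–Clozel Ch. 3 (2.2) for Borel–Jacquet data, the Literature named fact BY NAME
(a THEOREM of the literature, a T0 debt of the tree hanging on its four `L²` leaves,
`JacquetShalika1981_partialPairL_boundary_repData_of_L2_leaves`; = item stmt-Langlands-13622 `IrreducibilityBySelfDuality.PairLBoundaryJS`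
definitionally).  [cite: ArthurClozelAMS120, Ch. 3 §2 (2.2)] [cite: JacquetShalikaAJM1981II, Prop. 3.6 and Thm. 4.4] -/
theorem stub_pairLBoundaryJS : Literature.NumberTheory.Automorphic.JacquetShalika1981_partialPairL_boundary_repData := by
  sorry

/-- **stub JS (2.3)** — Jacquet–Shalika / Arthur–Clozel Ch. 3 (2.3) for Borel–Jacquet data, the Literature named fact BY NAME
(a THEOREM of the literature; T0 debt hanging on the single `L²` leaf `JacquetShalika1981_partialPairL_pole_of_eq_conj`,
`JacquetShalika1981_partialPairL_pole_repData_of_pole_of_eq_conj`; rank one is already the theorem `…_pole_repData_one`).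
[cite: ArthurClozelAMS120, Ch. 3 §2 (2.3)] [cite: JacquetShalikaAJM1981II, Prop. 3.6] -/
theorem stub_pairLPoleJS : Literature.NumberTheory.Automorphic.JacquetShalika1981_partialPairL_pole_repData := by
  sorry

/-! ## 2. The stub statements as named propositions (hypotheses of the composition, admissible by stub name)

Each `_Goal.stub_x` is `type_of% @stub_x`: literally the stub's statement, no text duplicated, no `sorry` inherited. -/

namespace _Goal

/-- The statement of `stub_weakExistence` (literally its type). [folklore] -/
def stub_weakExistence : Prop :=
  type_of% @Summit.Langlands.Langlands.Cruxes.SectorComplement.BirthMirrorPairReflection.stub_weakExistence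

/-- The statement of `stub_weakAutomorphyOffSector` (literally its type). [folklore] -/
def stub_weakAutomorphyOffSector : Prop :=
  type_of% @Summit.Langlands.Langlands.Cruxes.SectorComplement.BirthMirrorPairReflection.stub_weakAutomorphyOffSector

/-- The statement of `stub_sectorAutomorphyOfClassification` (literally its type). [folklore] -/
def stub_sectorAutomorphyOfClassification : Prop :=
  type_of% @Summit.Langlands.Langlands.Cruxes.SectorComplement.BirthMirrorPairReflection.stub_sectorAutomorphyOfClassification

/-- The statement of `stub_pairCompatibility` (literally its type). [folklore] -/
def stub_pairCompatibility : Prop :=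
  type_of% @Summit.Langlands.Langlands.Cruxes.SectorComplement.BirthMirrorPairReflection.stub_pairCompatibility

/-- The statement of `stub_pairLBoundaryJS` (literally its type). [folklore] -/
def stub_pairLBoundaryJS : Prop :=
  type_of% @Summit.Langlands.Langlands.Cruxes.SectorComplement.BirthMirrorPairReflection.stub_pairLBoundaryJS

/-- The statement of `stub_pairLPoleJS` (literally its type). [folklore] -/
def stub_pairLPoleJS : Prop :=
  type_of% @Summit.Langlands.Langlands.Cruxes.SectorComplement.BirthMirrorPairReflection.stub_pairLPoleJS

end _Goal

/-! ## 3. The composition (kernel-checked, no `sorry`): W → B_w⁻ → (X → B_w⁺) → LGC → JS (2.2) → JS (2.3) → SectorComplement -/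

/-- **`SectorComplement` from its six stubs.**  Given `X` (the crux's antecedent), B_w is rebuilt from its two halves by a case
split on X's sector (`X` discharges the sector through `stub_sectorAutomorphyOfClassification`); then, verbatim, the sibling's
isobaric bootstrap (irreducibility of W's avatar: geometric constituents + de Rham heredity, B_w on the constituents,
Jacquet–Shalika rigidity), the packaging of reciprocity-up-to-irreducibility for the `Rec` of LGC, and the landed structural
`IrreducibleOffSector.langlands_of_reciprocityUpToIrreducibility_text_of_JS`.  Hypotheses = the six stub statements by name;
conclusion = the route decl by name.  [cite: BuzzardGeeLMS2014, Conj. 3.2.1 and Conj. 3.2.2]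
[cite: ArthurClozelAMS120, Ch. 3 §2 (2.2)–(2.3)] [cite: CalegariGee2013, §1.1] [cite: DeligneSerreASENS1974, Lemme 3.2] -/
theorem SectorComplement_of (hW : _Goal.stub_weakExistence) (hOff : _Goal.stub_weakAutomorphyOffSector)
    (hOn : _Goal.stub_sectorAutomorphyOfClassification) (hL : _Goal.stub_pairCompatibility)
    (hJSb : _Goal.stub_pairLBoundaryJS) (hJSp : _Goal.stub_pairLPoleJS) : SectorComplement := by
  rw [sectorComplement_iff]
  intro hX
  dsimp only [_Goal.stub_weakExistence, _Goal.stub_weakAutomorphyOffSector, _Goal.stub_sectorAutomorphyOfClassification,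
    _Goal.stub_pairCompatibility, _Goal.stub_pairLBoundaryJS, _Goal.stub_pairLPoleJS] at hW hOff hOn hL hJSb hJSp
  -- B_w (Fontaine–Mazur–Langlands, a.e. form) from its two halves: X's sector is discharged by X
  have hB : ∀ (K : Type) [Field K] [NumberField K] (n : ℕ) (hcpt : Literature.NumberTheory.Automorphic.isCompact_glFiniteIntegralLevel n K), 0 < n → ∀ (ℓ : ℕ) [Fact ℓ.Prime] (ι : PadicAlgCl ℓ ≃+* ℂ) (ρ : Literature.NumberTheory.GaloisRepresentations.FramedGaloisRep K (PadicAlgCl ℓ) n), ρ.toGaloisRep.IsIrreducible → ((∀ᶠ v : IsDedekindDomain.HeightOneSpectrum (NumberField.RingOfIntegers K) in cofinite, ρ.IsUnramifiedAt v) ∧ ∀ (v : IsDedekindDomain.HeightOneSpectrum (NumberField.RingOfIntegers K)) (hv : ((ℓ : ℕ) : NumberField.RingOfIntegers K) ∈ v.asIdeal), (Literature.NumberTheory.PAdicHodge.fontainePstAdicCompletion v ℓ hv).IsDeRhamFramed (ρ.toLocal v)) → ∃ π : Literature.NumberTheory.Automorphic.CuspidalAutomorphicRepData n K hcpt, π.1.IsLAlgebraic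 ∧ ∀ᶠ v : IsDedekindDomain.HeightOneSpectrum (NumberField.RingOfIntegers K) in cofinite, SatakeFrobCompatibleAt ι π.1 ρ v := by
    intro K _ _ n hcpt hn ℓ _ ι ρ hirr hgeo
    by_cases hs : (Module.finrank ℚ K = 1 ∧ n = 2 ∧ ℓ ≠ 2 ∧ (∀ v : IsDedekindDomain.HeightOneSpectrum (NumberField.RingOfIntegers K), ((ℓ : ℕ) : NumberField.RingOfIntegers K) ∉ v.asIdeal → ρ.IsUnramifiedAt v) ∧ ∃ a b : ℕ, Even (a + b) ∧ ∀ g : Field.absoluteGaloisGroup K, ‖Literature.NumberTheory.GaloisRepresentations.FramedRep.trace ρ g - ((algebraMap ℚ_[ℓ] (PadicAlgCl ℓ) (((Literature.NumberTheory.GaloisRepresentations.GaloisRep.cyclotomicCharacter K ℓ g : ℤ_[ℓ]ˣ) : ℤ_[ℓ]) : ℚ_[ℓ])) ^ a + (algebraMap ℚ_[ℓ] (PadicAlgCl ℓ) (((Literature.NumberTheory.GaloisRepresentations.GaloisRep.cyclotomicCharacter K ℓ g : ℤ_[ℓ]ˣ) : ℤ_[ℓ]) : ℚ_[ℓ]))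 ^ b)‖ < 1)
    · obtain ⟨hK, rfl, hℓ, hur, a, b, hab, htr⟩ := hs
      exact hOn hX K hK hcpt ℓ hℓ ι ρ hirr hgeo hur a b hab htr
    · exact hOff K n hcpt hn ℓ ι ρ hirr hgeo hs
  -- the isobaric bootstrap, run with B_w: a pinned-geometric avatar of a cuspidal `π` is irreducible
  have irr : ∀ (K : Type) [Field K] [NumberField K] (n : ℕ) (hcpt : isCompact_glFiniteIntegralLevel n K)
      (_ : 0 < n) (π : CuspidalAutomorphicRepData n K hcpt) (ℓ : ℕ) [Fact ℓ.Prime]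
      (ι : PadicAlgCl ℓ ≃+* ℂ) (ρ : FramedGaloisRep K (PadicAlgCl ℓ) n),
      ((∀ᶠ v : HeightOneSpectrum (𝓞 K) in cofinite, ρ.IsUnramifiedAt v) ∧
        ∀ (v : HeightOneSpectrum (𝓞 K)) (hv : ((ℓ : ℕ) : 𝓞 K) ∈ v.asIdeal),
          (Literature.NumberTheory.PAdicHodge.fontainePstAdicCompletion v ℓ hv).IsDeRhamFramed
            (ρ.toLocal v)) →
      (∀ᶠ v : HeightOneSpectrum (𝓞 K) in cofinite, SatakeFrobCompatibleAt ι π.1 ρ v) →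
        ρ.toGaloisRep.IsIrreducible := by
    intro K _ _ n hcpt hn π ℓ _ ι ρ hgeo hρ
    obtain ⟨k, m, r, hr, hchar, -, hone⟩ :=
      stub_geometricConstituents stub_deRhamBlocks K ℓ n ρ hn hgeo
    by_cases hk1 : k = 1
    · exact hone hk1
    have hk0 : k ≠ 0 := by
      rintro rfl
      have h1 := hchar 1
      simp only [Finset.univ_eq_empty, Finset.prod_empty] at h1
      have hdeg : (FramedRep.charpoly ρ 1).natDegree = n := by
        simp [FramedRep.charpoly, Matrix.charpoly_natDegree_eq_dim]
      rw [h1, natDegree_one] at hdeg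
      omega
    have hk2 : 2 ≤ k := by omega
    have hσ : ∀ i, ∃ σ : CuspidalAutomorphicRepData (m i) K
        (isCompact_glFiniteIntegralLevel_holds (m i) K),
        ∀ᶠ v : HeightOneSpectrum (𝓞 K) in cofinite, SatakeFrobCompatibleAt ι σ.1 (r i) v := by
      intro i
      obtain ⟨σ, -, hcorr⟩ := hB K (m i) (isCompact_glFiniteIntegralLevel_holds (m i) K) (hr i).1 ℓ ι
        (r i) (hr i).2.1 (hr i).2.2
      exact ⟨σ, hcorr⟩
    choose σ hσc using hσ
    refine (stub_isobaricRigidity hJSb hJSp K n hcpt π k m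
      (fun i => isCompact_glFiniteIntegralLevel_holds (m i) K) σ hn hk2 (fun i => (hr i).1) ?_).elim
    have hall : ∀ᶠ v : HeightOneSpectrum (𝓞 K) in cofinite,
        ∀ i, SatakeFrobCompatibleAt ι (σ i).1 (r i) v :=
      Filter.eventually_all.mpr hσc
    filter_upwards [hρ, hall] with v hv hvi
    intro α hα
    obtain ⟨α₀, hα₀, -, hcp⟩ := hv
    obtain rfl : α = α₀ := AutomorphicRepData.hasSatakeParamAt_unique_holds π.1 hα hα₀
    choose β hβ _hurβ hcpβ using hvi
    refine ⟨β, hβ, ?_⟩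
    have hprod : ρ.HasFrobCharpolyAt v (∏ i, arithFrobPolyOfSatake ι v.residueCard 1 (β i)) := by
      intro 𝔓 h𝔓 τ hτ
      rw [hchar τ]
      exact Finset.prod_congr rfl fun i _ => hcpβ i 𝔓 h𝔓 τ hτ
    rw [← Summit.Langlands.Langlands.Theorems.IrreducibleOffSector.arithFrobPolyOfSatake_sum] at hprod
    have heq : arithFrobPolyOfSatake ι v.residueCard 1 α =
        arithFrobPolyOfSatake ι v.residueCard 1 (∑ i, β i) :=
      GaloisRep.HasFrobCharpolyAt.unique_holds
        ((FramedGaloisRep.hasFrobCharpolyAt_toGaloisRep_iff v _ ρ).mpr hcp)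
        ((FramedGaloisRep.hasFrobCharpolyAt_toGaloisRep_iff v _ ρ).mpr hprod)
    exact arithFrobPolyOfSatake_one_injective ι _ heq
  -- reciprocity up to irreducibility (the text of crux stmt-Langlands-14328) for the `Rec` of LGC
  have hE : ∀ (F : Type) [Field F] [NumberField F], ∃ Rec : ReciprocityData F, ∀ n : ℕ, 0 < n →
      ∀ hcpt : isCompact_glFiniteIntegralLevel n F,
        (∀ π : CuspidalAutomorphicRepData n F hcpt, π.1.IsLAlgebraic →
          ∀ (ℓ : ℕ) [Fact ℓ.Prime] (ι : PadicAlgCl ℓ ≃+* ℂ),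
            ∃ ρ : FramedGaloisRep F (PadicAlgCl ℓ) n, IsGeometricFramed Rec ρ ∧ Corresponds Rec ι π.1 ρ) ∧
        GaloisToAutomorphic n Rec hcpt := by
    intro F _ _
    obtain ⟨Rec, hRec⟩ := hL F
    refine ⟨Rec, fun n hn hcpt => ⟨fun π hLalg ℓ _ ι => ?_, fun ℓ _ ι ρ hirr hgeo => ?_⟩⟩
    · obtain ⟨ρ, hgeo, hρ⟩ := hW F n hcpt hn π hLalg ℓ ι
      have hirr : ρ.toGaloisRep.IsIrreducible := irr F n hcpt hn π ℓ ι ρ hgeo hρ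
      exact ⟨ρ, hgeo, hρ, hRec n hcpt hn π hLalg ℓ ι ρ hirr hgeo hρ⟩
    · obtain ⟨π, hLalg, hρ⟩ := hB F n hcpt hn ℓ ι ρ hirr hgeo
      exact ⟨π, hLalg, hρ, hRec n hcpt hn π hLalg ℓ ι ρ hirr hgeo hρ⟩
  -- the summit: irreducibility of every avatar and Chebotarev–Brauer–Nesbitt uniqueness (landed, structural)
  exact Summit.Langlands.Langlands.Theorems.IrreducibleOffSector.langlands_of_reciprocityUpToIrreducibility_text_of_JS
    hJSb hJSp hE

/-- By-name sanity check (an `example`, not a declaration): the six stubs feed the composition as they stand. -/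
example : SectorComplement :=
  SectorComplement_of stub_weakExistence stub_weakAutomorphyOffSector stub_sectorAutomorphyOfClassification
    stub_pairCompatibility stub_pairLBoundaryJS stub_pairLPoleJS

end Summit.Langlands.Langlands.Cruxes.SectorComplement.BirthMirrorPairReflection

end
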